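import Mathlib
import HarnessLib
import Summits.NavierStokesRegularity.NavierStokesRegularity.Theorems.PoloidalWindowDoorPoloidalWindowRigidityTimeHeightShearNormalForm
import Summits.NavierStokesRegularity.NavierStokesRegularity.Theorems.PoloidalWindowDoorLrcModEntireTwistingTHLocalHypGerm

/-!
# Item `LrcModEntire` (stmt-NavierStokesRegularity-20428), skeleton twist_split v6 — the GLOBAL ROAD to the registered (TH) stub
# `stub_twistingTHGerm`: it suffices to refute a profile whose (TH) structure is displayed on EVERY PLANE OF EVERY SLICE

LEAD ns-poloidal-K2-p3 g12 (prover-ns-poloidal-K2-p3-g12-0), `--supports stmt-NavierStokesRegularity-20428 --as helper`.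

The registered (TH)∩twisting stub of `Cruxes/LrcModEntire/Lines/twist_split.lean` v6 is CLASS-LEVEL: a Type-I ancient mild poloidal profile,
normalised at the hot spot `(−1,0)`, with a non-degenerate pinned TWISTING window on which the shear slope is SOME function `m(t, x₂)`, has a
vorticity-symmetry germ.  By ns-poloidal-K2-p2 g4's `…TimeHeightShearNormalForm.timeHeightShear_normalForm` the local (TH) identity propagates
to the whole profile: EVERY horizontal plane of EVERY slice is either horizontally flat (`∇ₕv₂ ≡ 0` on it) or proportional-shear with ONE slope.
This file packages that fact as a reduction a global prover can target BY NAME: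

* `twistingTHGerm_of_globalForm` — if every class + poloidal + hot-spot-normalised profile carrying a GLOBAL slope function
  `μ : ℝ → ℝ → ℝ` (flat-or-proportional dichotomy on every plane `{y₂ = c}` of every slice `s < 0`) and a non-degenerate pinned twisting window
  on which the slope IS `μ` and is not a function of time alone on any sub-window is contradictory, then `stub_twistingTHGerm` holds (verbatim
  statement; the germ conclusion is reached by `exfalso`).

So the (TH) column has two named sufficient conditions: the LOCAL road (`twistingTHGerm_of_localTHEmptyHypNUGRS` in the skeleton: an EMPTY
certificate of the local jet scheme) and this GLOBAL road (a Liouville-type theorem for profiles that are (TH) on every plane; located obstruction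
of record: K2-p2 TH-STEP2 §3–4 — the critical quadratic self-interaction in `𝓛[(1−μ)v₂] = A(t,z) − (μ_z/2)v₂²`).
WHAT THIS IS NOT: not a claim about Navier–Stokes regularity and not the stub — a sorry-free reduction (bears_on LADDER-NS N0, item 20428 / crux 19708).
-/

noncomputable section

set_option linter.dupNamespace false

namespace Summit.NavierStokesRegularity.NavierStokesRegularity.Theorems.PoloidalWindowDoorLrcModEntireTwistingTHGlobalForm

open MeasureTheory Set Function Filter Topology Metric
open scoped RealInnerProductSpace InnerProductSpace Laplacian
open Literature.Analysis Literature.Analysis.FluidPDE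
open Summit.NavierStokesRegularity.NavierStokesRegularity.Theorems.PoloidalWindowDoorPoloidalWindowRigidityTimeHeightShearNormalForm

/-- **GLOBAL ROAD to `stub_twistingTHGerm` (twist_split v6).**  Hypothesis `hG`: no class + poloidal + hot-spot-normalised profile admits a global
slope function `μ` with the flat-or-proportional dichotomy on every plane of every slice TOGETHER WITH a non-degenerate pinned twisting window on
which the slope is `μ` and is not time-only on any sub-window.  Conclusion: VERBATIM the registered stub `stub_twistingTHGerm` (class + poloidal +
hot-spot pins + such a window with SOME slope `m(t,x₂)` ⇒ germ trichotomy).  Proof: choose the plane slopes given by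
`timeHeightShear_normalForm` (planes through the window are not flat because of the pin `∇ₕv₂ ≠ 0`), feed `hG`, `exfalso`. -/
theorem twistingTHGerm_of_globalForm
    (hG :
    ∀ (C : ℝ) (v : ℝ → EuclideanSpace ℝ (Fin 3) → EuclideanSpace ℝ (Fin 3)),
      Literature.Analysis.FluidPDE.HasTypeITimeDecay C v →
      ContinuousOn (Function.uncurry v) (Set.Iio (0 : ℝ) ×ˢ Set.univ) →
      (∀ s t : ℝ, s < t → t < 0 → ∀ x, v t x =
        Literature.Analysis.UnboundedOperators.heatExtension (v s) (t - s) x -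
          Literature.Analysis.FluidPDE.oseenDuhamel 1 s v v t x) →
      (∀ t < 0, Literature.Analysis.FluidPDE.VectorCalculus.IsDivFree (v t)) →
      (∀ s < 0, ∀ y, ⟪Literature.Analysis.FluidPDE.curl (v s) y, EuclideanSpace.single 2 1⟫_ℝ = 0) →
      v (-1) 0 2 ≠ 0 → (∀ t < 0, ∀ x, Real.sqrt (-t) * |v t x 2| ≤ |v (-1) 0 2|) →
      (∀ h : EuclideanSpace ℝ (Fin 3), fderiv ℝ (v (-1)) 0 h 2 = 0) →
      (deriv (fun s => v s 0 2) (-1) = v (-1) 0 2 / 2 ∧ v (-1) 0 2 * (Δ (fun y => v (-1) y 2)) 0 ≤ 0) →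
      ∀ μ : ℝ → ℝ → ℝ,
        (∀ s < 0, ∀ c : ℝ,
          (∀ y : EuclideanSpace ℝ (Fin 3), y 2 = c →
              fderiv ℝ (v s) y (EuclideanSpace.single 0 1) 2 = 0 ∧ fderiv ℝ (v s) y (EuclideanSpace.single 1 1) 2 = 0) ∨
            (∀ y : EuclideanSpace ℝ (Fin 3), y 2 = c → ∀ b : Fin 3, b ≠ 2 →
              fderiv ℝ (v s) y (EuclideanSpace.single 2 1) b = μ s c * fderiv ℝ (v s) y (EuclideanSpace.single b 1) 2)) →
      ∀ W : Set (ℝ × EuclideanSpace ℝ (Fin 3)), IsOpen W → W.Nonempty → W ⊆ Set.Iio (0 : ℝ) ×ˢ Set.univ →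
        (∀ z ∈ W, (Literature.Analysis.FluidPDE.curl (v z.1) z.2 ≠ 0 ∧
            (fderiv ℝ (v z.1) z.2 (EuclideanSpace.single 0 1) 2 ≠ 0 ∨ fderiv ℝ (v z.1) z.2 (EuclideanSpace.single 1 1) 2 ≠ 0) ∧
            (fderiv ℝ (v z.1) z.2 (EuclideanSpace.single 2 1) 0 ≠ 0 ∨ fderiv ℝ (v z.1) z.2 (EuclideanSpace.single 2 1) 1 ≠ 0))) →
        (∀ m : ℝ → ℝ, ∀ W₁ : Set (ℝ × EuclideanSpace ℝ (Fin 3)), W₁ ⊆ W → IsOpen W₁ → W₁.Nonempty →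
            ∃ z ∈ W₁, ∃ b : Fin 3, b ≠ 2 ∧
              fderiv ℝ (v z.1) z.2 (EuclideanSpace.single 2 1) b ≠
                m z.1 * fderiv ℝ (v z.1) z.2 (EuclideanSpace.single b 1) 2) →
        (∀ z ∈ W, (fderiv ℝ (fun x => fderiv ℝ (v z.1) x (EuclideanSpace.single 2 1) 2) z.2 (EuclideanSpace.single 0 1) *
                fderiv ℝ (v z.1) z.2 (EuclideanSpace.single 1 1) 2 -
              fderiv ℝ (fun x => fderiv ℝ (v z.1) x (EuclideanSpace.single 2 1) 2) z.2 (EuclideanSpace.single 1 1) *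
                fderiv ℝ (v z.1) z.2 (EuclideanSpace.single 0 1) 2 ≠ 0)) →
        (∀ z ∈ W, ∀ b : Fin 3, b ≠ 2 →
            fderiv ℝ (v z.1) z.2 (EuclideanSpace.single 2 1) b =
              μ z.1 (z.2 2) * fderiv ℝ (v z.1) z.2 (EuclideanSpace.single b 1) 2) →
        False) :
    ∀ (C : ℝ) (v : ℝ → EuclideanSpace ℝ (Fin 3) → EuclideanSpace ℝ (Fin 3)),
      Literature.Analysis.FluidPDE.HasTypeITimeDecay C v →
      ContinuousOn (Function.uncurry v) (Set.Iio (0 : ℝ) ×ˢ Set.univ) →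
      (∀ s t : ℝ, s < t → t < 0 → ∀ x, v t x =
        Literature.Analysis.UnboundedOperators.heatExtension (v s) (t - s) x -
          Literature.Analysis.FluidPDE.oseenDuhamel 1 s v v t x) →
      (∀ t < 0, Literature.Analysis.FluidPDE.VectorCalculus.IsDivFree (v t)) →
      (∀ s < 0, ∀ y, ⟪Literature.Analysis.FluidPDE.curl (v s) y, EuclideanSpace.single 2 1⟫_ℝ = 0) →
      v (-1) 0 2 ≠ 0 → (∀ t < 0, ∀ x, Real.sqrt (-t) * |v t x 2| ≤ |v (-1) 0 2|) →
      (∀ h : EuclideanSpace ℝ (Fin 3), fderiv ℝ (v (-1)) 0 h 2 = 0) →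
      (deriv (fun s => v s 0 2) (-1) = v (-1) 0 2 / 2 ∧ v (-1) 0 2 * (Δ (fun y => v (-1) y 2)) 0 ≤ 0) →
      ∀ W : Set (ℝ × EuclideanSpace ℝ (Fin 3)), IsOpen W → W.Nonempty → W ⊆ Set.Iio (0 : ℝ) ×ˢ Set.univ →
        (∀ z ∈ W, (Literature.Analysis.FluidPDE.curl (v z.1) z.2 ≠ 0 ∧
            (fderiv ℝ (v z.1) z.2 (EuclideanSpace.single 0 1) 2 ≠ 0 ∨ fderiv ℝ (v z.1) z.2 (EuclideanSpace.single 1 1) 2 ≠ 0) ∧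
            (fderiv ℝ (v z.1) z.2 (EuclideanSpace.single 2 1) 0 ≠ 0 ∨ fderiv ℝ (v z.1) z.2 (EuclideanSpace.single 2 1) 1 ≠ 0))) →
        (∀ m : ℝ → ℝ, ∀ W₁ : Set (ℝ × EuclideanSpace ℝ (Fin 3)), W₁ ⊆ W → IsOpen W₁ → W₁.Nonempty →
            ∃ z ∈ W₁, ∃ b : Fin 3, b ≠ 2 ∧
              fderiv ℝ (v z.1) z.2 (EuclideanSpace.single 2 1) b ≠
                m z.1 * fderiv ℝ (v z.1) z.2 (EuclideanSpace.single b 1) 2) →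
        (∀ z ∈ W, (fderiv ℝ (fun x => fderiv ℝ (v z.1) x (EuclideanSpace.single 2 1) 2) z.2 (EuclideanSpace.single 0 1) *
                fderiv ℝ (v z.1) z.2 (EuclideanSpace.single 1 1) 2 -
              fderiv ℝ (fun x => fderiv ℝ (v z.1) x (EuclideanSpace.single 2 1) 2) z.2 (EuclideanSpace.single 1 1) *
                fderiv ℝ (v z.1) z.2 (EuclideanSpace.single 0 1) 2 ≠ 0)) →
        (∃ m : ℝ → ℝ → ℝ, ∀ z ∈ W, ∀ b : Fin 3, b ≠ 2 →
            fderiv ℝ (v z.1) z.2 (EuclideanSpace.single 2 1) b =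
              m z.1 (z.2 2) * fderiv ℝ (v z.1) z.2 (EuclideanSpace.single b 1) 2) →
        ∃ s : ℝ, s < 0 ∧ ∃ U : Set (EuclideanSpace ℝ (Fin 3)), IsOpen U ∧ U.Nonempty ∧
          ((∃ e : EuclideanSpace ℝ (Fin 3), e ≠ 0 ∧
              ∀ y ∈ U, fderiv ℝ (Literature.Analysis.FluidPDE.curl (v s)) y e = 0) ∨
           (∃ c : EuclideanSpace ℝ (Fin 3), ∀ y ∈ U,
              Literature.Analysis.FluidPDE.rotGen (Literature.Analysis.FluidPDE.curl (v s) y) =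
                fderiv ℝ (Literature.Analysis.FluidPDE.curl (v s)) y (Literature.Analysis.FluidPDE.rotGen (y - c))) ∨
           (∃ w : EuclideanSpace ℝ (Fin 3) → EuclideanSpace ℝ (Fin 3), AnalyticOnNhd ℝ w Set.univ ∧
              ¬ BddAbove (Set.range fun y => ‖w y‖) ∧ ∀ y ∈ U, v s y = w y)) := by
  intro C v hrate hcont hmild hdiv hpol hne hhot hthread hpins W hW hWne hWs hnd hntv htw hTH
  exfalso
  obtain ⟨m, hm⟩ := hTH
  -- the global normal form: every plane of every slice is flat or proportional-shear
  have hNF := timeHeightShear_normalForm hrate hcont hmild hW hWne hWs hm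
  classical
  -- a global choice of plane slopes (0 on planes where no slope exists — never used)
  let μ : ℝ → ℝ → ℝ := fun s c =>
    if h : ∃ μ' : ℝ, ∀ y : EuclideanSpace ℝ (Fin 3), y 2 = c → ∀ b : Fin 3, b ≠ 2 →
        fderiv ℝ (v s) y (EuclideanSpace.single 2 1) b = μ' * fderiv ℝ (v s) y (EuclideanSpace.single b 1) 2
    then h.choose else 0
  have hμ : ∀ s < 0, ∀ c : ℝ,
      (∀ y : EuclideanSpace ℝ (Fin 3), y 2 = c →
          fderiv ℝ (v s) y (EuclideanSpace.single 0 1) 2 = 0 ∧ fderiv ℝ (v s) y (EuclideanSpace.single 1 1) 2 = 0) ∨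
        (∀ y : EuclideanSpace ℝ (Fin 3), y 2 = c → ∀ b : Fin 3, b ≠ 2 →
          fderiv ℝ (v s) y (EuclideanSpace.single 2 1) b = μ s c * fderiv ℝ (v s) y (EuclideanSpace.single b 1) 2) := by
    intro s hs c
    rcases hNF s hs c with hflat | hex
    · exact Or.inl hflat
    · right
      have hdef : μ s c = hex.choose := by
        simp only [μ, dif_pos hex]
      rw [hdef]
      exact hex.choose_spec
  -- on the window the slope IS μ: the plane through a window point is not flat (pin), so the slope branch holds there
  have hWμ : ∀ z ∈ W, ∀ b : Fin 3, b ≠ 2 →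
      fderiv ℝ (v z.1) z.2 (EuclideanSpace.single 2 1) b =
        μ z.1 (z.2 2) * fderiv ℝ (v z.1) z.2 (EuclideanSpace.single b 1) 2 := by
    intro z hz b hb
    have hz1 : z.1 < 0 := (Set.mem_prod.1 (hWs hz)).1
    rcases hμ z.1 hz1 (z.2 2) with hflat | hslope
    · exfalso
      rcases (hnd z hz).2.1 with h0 | h1
      · exact h0 (hflat z.2 rfl).1
      · exact h1 (hflat z.2 rfl).2
    · exact hslope z.2 rfl b hb
  exact hG C v hrate hcont hmild hdiv hpol hne hhot hthread hpins μ hμ W hW hWne hWs hnd hntv htw hWμ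

/-! ### The HYPERBOLIC global road: one may assume the twisting window is of negative type and the slope is negative on it -/

/-- **HYPERBOLIC GLOBAL ROAD to `stub_twistingTHGerm`.**  As `twistingTHGerm_of_globalForm`, but the contradiction need only be derived for a
twisting window that is HYPERBOLIC — type scalar `∂₂v₀∂₀v₂ + ∂₂v₁∂₁v₂ < 0` and slope `μ(t,x₂) < 0` at every point of the window — which is the
setting of the located obstruction (TH-STEP2) and of the local stub's pin `μ < 0`.  Proof: relocate the given window to a hyperbolic one by
K2-p2 g6's `exists_hyperbolicTHWindow` (tree, `…TwistingTHLocalHypGerm`), choose the global plane slopes by `timeHeightShear_normalForm`, read the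
sign of `μ` off the type scalar, feed `hG`, `exfalso`. -/
theorem twistingTHGerm_of_globalHypForm
    (hG :
    ∀ (C : ℝ) (v : ℝ → EuclideanSpace ℝ (Fin 3) → EuclideanSpace ℝ (Fin 3)),
      Literature.Analysis.FluidPDE.HasTypeITimeDecay C v →
      ContinuousOn (Function.uncurry v) (Set.Iio (0 : ℝ) ×ˢ Set.univ) →
      (∀ s t : ℝ, s < t → t < 0 → ∀ x, v t x =
        Literature.Analysis.UnboundedOperators.heatExtension (v s) (t - s) x -
          Literature.Analysis.FluidPDE.oseenDuhamel 1 s v v t x) →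
      (∀ t < 0, Literature.Analysis.FluidPDE.VectorCalculus.IsDivFree (v t)) →
      (∀ s < 0, ∀ y, ⟪Literature.Analysis.FluidPDE.curl (v s) y, EuclideanSpace.single 2 1⟫_ℝ = 0) →
      v (-1) 0 2 ≠ 0 → (∀ t < 0, ∀ x, Real.sqrt (-t) * |v t x 2| ≤ |v (-1) 0 2|) →
      (∀ h : EuclideanSpace ℝ (Fin 3), fderiv ℝ (v (-1)) 0 h 2 = 0) →
      (deriv (fun s => v s 0 2) (-1) = v (-1) 0 2 / 2 ∧ v (-1) 0 2 * (Δ (fun y => v (-1) y 2)) 0 ≤ 0) →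
      ∀ μ : ℝ → ℝ → ℝ,
        (∀ s < 0, ∀ c : ℝ,
          (∀ y : EuclideanSpace ℝ (Fin 3), y 2 = c →
              fderiv ℝ (v s) y (EuclideanSpace.single 0 1) 2 = 0 ∧ fderiv ℝ (v s) y (EuclideanSpace.single 1 1) 2 = 0) ∨
            (∀ y : EuclideanSpace ℝ (Fin 3), y 2 = c → ∀ b : Fin 3, b ≠ 2 →
              fderiv ℝ (v s) y (EuclideanSpace.single 2 1) b = μ s c * fderiv ℝ (v s) y (EuclideanSpace.single b 1) 2)) →
      ∀ W : Set (ℝ × EuclideanSpace ℝ (Fin 3)), IsOpen W → W.Nonempty → W ⊆ Set.Iio (0 : ℝ) ×ˢ Set.univ →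
        (∀ z ∈ W, (Literature.Analysis.FluidPDE.curl (v z.1) z.2 ≠ 0 ∧
            (fderiv ℝ (v z.1) z.2 (EuclideanSpace.single 0 1) 2 ≠ 0 ∨ fderiv ℝ (v z.1) z.2 (EuclideanSpace.single 1 1) 2 ≠ 0) ∧
            (fderiv ℝ (v z.1) z.2 (EuclideanSpace.single 2 1) 0 ≠ 0 ∨ fderiv ℝ (v z.1) z.2 (EuclideanSpace.single 2 1) 1 ≠ 0))) →
        (∀ m : ℝ → ℝ, ∀ W₁ : Set (ℝ × EuclideanSpace ℝ (Fin 3)), W₁ ⊆ W → IsOpen W₁ → W₁.Nonempty →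
            ∃ z ∈ W₁, ∃ b : Fin 3, b ≠ 2 ∧
              fderiv ℝ (v z.1) z.2 (EuclideanSpace.single 2 1) b ≠
                m z.1 * fderiv ℝ (v z.1) z.2 (EuclideanSpace.single b 1) 2) →
        (∀ z ∈ W, (fderiv ℝ (fun x => fderiv ℝ (v z.1) x (EuclideanSpace.single 2 1) 2) z.2 (EuclideanSpace.single 0 1) *
                fderiv ℝ (v z.1) z.2 (EuclideanSpace.single 1 1) 2 -
              fderiv ℝ (fun x => fderiv ℝ (v z.1) x (EuclideanSpace.single 2 1) 2) z.2 (EuclideanSpace.single 1 1) *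
                fderiv ℝ (v z.1) z.2 (EuclideanSpace.single 0 1) 2 ≠ 0)) →
        (∀ z ∈ W,
          fderiv ℝ (v z.1) z.2 (EuclideanSpace.single 2 1) 0 * fderiv ℝ (v z.1) z.2 (EuclideanSpace.single 0 1) 2 +
            fderiv ℝ (v z.1) z.2 (EuclideanSpace.single 2 1) 1 * fderiv ℝ (v z.1) z.2 (EuclideanSpace.single 1 1) 2 < 0) →
        (∀ z ∈ W, μ z.1 (z.2 2) < 0) →
        (∀ z ∈ W, ∀ b : Fin 3, b ≠ 2 →
            fderiv ℝ (v z.1) z.2 (EuclideanSpace.single 2 1) b =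
              μ z.1 (z.2 2) * fderiv ℝ (v z.1) z.2 (EuclideanSpace.single b 1) 2) →
        False) :
    ∀ (C : ℝ) (v : ℝ → EuclideanSpace ℝ (Fin 3) → EuclideanSpace ℝ (Fin 3)),
      Literature.Analysis.FluidPDE.HasTypeITimeDecay C v →
      ContinuousOn (Function.uncurry v) (Set.Iio (0 : ℝ) ×ˢ Set.univ) →
      (∀ s t : ℝ, s < t → t < 0 → ∀ x, v t x =
        Literature.Analysis.UnboundedOperators.heatExtension (v s) (t - s) x -
          Literature.Analysis.FluidPDE.oseenDuhamel 1 s v v t x) →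
      (∀ t < 0, Literature.Analysis.FluidPDE.VectorCalculus.IsDivFree (v t)) →
      (∀ s < 0, ∀ y, ⟪Literature.Analysis.FluidPDE.curl (v s) y, EuclideanSpace.single 2 1⟫_ℝ = 0) →
      v (-1) 0 2 ≠ 0 → (∀ t < 0, ∀ x, Real.sqrt (-t) * |v t x 2| ≤ |v (-1) 0 2|) →
      (∀ h : EuclideanSpace ℝ (Fin 3), fderiv ℝ (v (-1)) 0 h 2 = 0) →
      (deriv (fun s => v s 0 2) (-1) = v (-1) 0 2 / 2 ∧ v (-1) 0 2 * (Δ (fun y => v (-1) y 2)) 0 ≤ 0) →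
      ∀ W : Set (ℝ × EuclideanSpace ℝ (Fin 3)), IsOpen W → W.Nonempty → W ⊆ Set.Iio (0 : ℝ) ×ˢ Set.univ →
        (∀ z ∈ W, (Literature.Analysis.FluidPDE.curl (v z.1) z.2 ≠ 0 ∧
            (fderiv ℝ (v z.1) z.2 (EuclideanSpace.single 0 1) 2 ≠ 0 ∨ fderiv ℝ (v z.1) z.2 (EuclideanSpace.single 1 1) 2 ≠ 0) ∧
            (fderiv ℝ (v z.1) z.2 (EuclideanSpace.single 2 1) 0 ≠ 0 ∨ fderiv ℝ (v z.1) z.2 (EuclideanSpace.single 2 1) 1 ≠ 0))) →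
        (∀ m : ℝ → ℝ, ∀ W₁ : Set (ℝ × EuclideanSpace ℝ (Fin 3)), W₁ ⊆ W → IsOpen W₁ → W₁.Nonempty →
            ∃ z ∈ W₁, ∃ b : Fin 3, b ≠ 2 ∧
              fderiv ℝ (v z.1) z.2 (EuclideanSpace.single 2 1) b ≠
                m z.1 * fderiv ℝ (v z.1) z.2 (EuclideanSpace.single b 1) 2) →
        (∀ z ∈ W, (fderiv ℝ (fun x => fderiv ℝ (v z.1) x (EuclideanSpace.single 2 1) 2) z.2 (EuclideanSpace.single 0 1) *
                fderiv ℝ (v z.1) z.2 (EuclideanSpace.single 1 1) 2 -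
              fderiv ℝ (fun x => fderiv ℝ (v z.1) x (EuclideanSpace.single 2 1) 2) z.2 (EuclideanSpace.single 1 1) *
                fderiv ℝ (v z.1) z.2 (EuclideanSpace.single 0 1) 2 ≠ 0)) →
        (∃ m : ℝ → ℝ → ℝ, ∀ z ∈ W, ∀ b : Fin 3, b ≠ 2 →
            fderiv ℝ (v z.1) z.2 (EuclideanSpace.single 2 1) b =
              m z.1 (z.2 2) * fderiv ℝ (v z.1) z.2 (EuclideanSpace.single b 1) 2) →
        ∃ s : ℝ, s < 0 ∧ ∃ U : Set (EuclideanSpace ℝ (Fin 3)), IsOpen U ∧ U.Nonempty ∧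
          ((∃ e : EuclideanSpace ℝ (Fin 3), e ≠ 0 ∧
              ∀ y ∈ U, fderiv ℝ (Literature.Analysis.FluidPDE.curl (v s)) y e = 0) ∨
           (∃ c : EuclideanSpace ℝ (Fin 3), ∀ y ∈ U,
              Literature.Analysis.FluidPDE.rotGen (Literature.Analysis.FluidPDE.curl (v s) y) =
                fderiv ℝ (Literature.Analysis.FluidPDE.curl (v s)) y (Literature.Analysis.FluidPDE.rotGen (y - c))) ∨
           (∃ w : EuclideanSpace ℝ (Fin 3) → EuclideanSpace ℝ (Fin 3), AnalyticOnNhd ℝ w Set.univ ∧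
              ¬ BddAbove (Set.range fun y => ‖w y‖) ∧ ∀ y ∈ U, v s y = w y)) := by
  intro C v hrate hcont hmild hdiv hpol hne hhot hthread hpins W hW hWne hWs hnd hntv htw hTH
  exfalso
  -- relocate to a hyperbolic twisting (TH) window
  obtain ⟨W', hW', hWne', hWs', hnd', hntv', htw', hhyp', hTH'⟩ :=
    Summit.NavierStokesRegularity.NavierStokesRegularity.Theorems.PoloidalWindowDoorLrcModEntireTwistingTHLocalHypGerm.exists_hyperbolicTHWindow
      C v hrate hcont hmild hdiv W hW hWne hWs hnd hntv htw hTH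
  obtain ⟨m, hm⟩ := hTH'
  have hNF := timeHeightShear_normalForm hrate hcont hmild hW' hWne' hWs' hm
  classical
  let μ : ℝ → ℝ → ℝ := fun s c =>
    if h : ∃ μ' : ℝ, ∀ y : EuclideanSpace ℝ (Fin 3), y 2 = c → ∀ b : Fin 3, b ≠ 2 →
        fderiv ℝ (v s) y (EuclideanSpace.single 2 1) b = μ' * fderiv ℝ (v s) y (EuclideanSpace.single b 1) 2
    then h.choose else 0
  have hμ : ∀ s < 0, ∀ c : ℝ,
      (∀ y : EuclideanSpace ℝ (Fin 3), y 2 = c →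
          fderiv ℝ (v s) y (EuclideanSpace.single 0 1) 2 = 0 ∧ fderiv ℝ (v s) y (EuclideanSpace.single 1 1) 2 = 0) ∨
        (∀ y : EuclideanSpace ℝ (Fin 3), y 2 = c → ∀ b : Fin 3, b ≠ 2 →
          fderiv ℝ (v s) y (EuclideanSpace.single 2 1) b = μ s c * fderiv ℝ (v s) y (EuclideanSpace.single b 1) 2) := by
    intro s hs c
    rcases hNF s hs c with hflat | hex
    · exact Or.inl hflat
    · right
      have hdef : μ s c = hex.choose := by
        simp only [μ, dif_pos hex]
      rw [hdef]
      exact hex.choose_spec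
  have hWμ : ∀ z ∈ W', ∀ b : Fin 3, b ≠ 2 →
      fderiv ℝ (v z.1) z.2 (EuclideanSpace.single 2 1) b =
        μ z.1 (z.2 2) * fderiv ℝ (v z.1) z.2 (EuclideanSpace.single b 1) 2 := by
    intro z hz b hb
    have hz1 : z.1 < 0 := (Set.mem_prod.1 (hWs' hz)).1
    rcases hμ z.1 hz1 (z.2 2) with hflat | hslope
    · exfalso
      rcases (hnd' z hz).2.1 with h0 | h1
      · exact h0 (hflat z.2 rfl).1
      · exact h1 (hflat z.2 rfl).2
    · exact hslope z.2 rfl b hb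
  have hμneg : ∀ z ∈ W', μ z.1 (z.2 2) < 0 := by
    intro z hz
    have h0 := hWμ z hz 0 (by decide)
    have h1 := hWμ z hz 1 (by decide)
    exact Summit.NavierStokesRegularity.NavierStokesRegularity.Theorems.PoloidalWindowDoorLrcModEntireTwistingTHLocalHypGerm.slope_neg_of_typeScalar_neg
      h0 h1 (hhyp' z hz)
  exact hG C v hrate hcont hmild hdiv hpol hne hhot hthread hpins μ hμ W' hW' hWne' hWs' hnd' hntv' htw' hhyp' hμneg hWμ

end Summit.NavierStokesRegularity.NavierStokesRegularity.Theorems.PoloidalWindowDoorLrcModEntireTwistingTHGlobalForm
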